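import Literature.MathematicalPhysics.QuantumFieldTheory.Balaban1983to89.B9Eq315QTowerLipschitz
import Literature.MathematicalPhysics.QuantumFieldTheory.Balaban1983to89.B9Eq379QLipschitzGeneral
import Literature.MathematicalPhysics.QuantumFieldTheory.Balaban1983to89.B9Eq368RLipschitzTwoBackgrounds

/-!
# `Balaban1983to89.B9Eq315QTowerLipschitzTwoBackgrounds` — T. Bałaban, *Propagators for lattice gauge theories in a background field*,
# Commun. Math. Phys. **99** (1985) 389–434 [Balaban1985BackgroundPropagators] (3.15)/(3.19) p. 393 with (3.78)–(3.81) p. 406: THE COMPOSITE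
# AVERAGINGS `Q_k(U)`, `Q′_k(U)` OF THE TOWER ARE LIPSCHITZ IN THE BACKGROUND BETWEEN TWO GENERAL BACKGROUNDS `U`, `U′` — the `k`-level
# twins of the one-step two-background moduli of NE9 leaf-03 (`B9Eq319QprimeLipschitzTwoBackgrounds`, print's `F′₂` at a general `V`) and
# NE9 leaf-04 (`B9Eq379QLipschitzGeneral`, print's `F₂` at a general `V`) by telescoping over the levels, modulo the DISPLAYED smallness,
# unit-boundedness and MUTUAL CLOSENESS of the two families of averaged backgrounds `Ū^j`, `Ū′^j`

statement-level skeleton of published theorems with citation tags; proofs where landed; nothing here is a claim about the Yang–Mills mass gap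

CITATION HEADER (lean-in-tree rule).  Audit cell `pub-balaban`, sub-cell `t4`, BINDER row NE9; filed by the NE9 crux-team leaf lineage
`b2b-balaban-t4-ne9-formalise-leaf-04` (gen 74).  Sources READ in the held texts: [Balaban1985BackgroundPropagators] pp. 393, 403, 406
(`paper:balaban1985-cmp99-background-propagators`, journal page = PDF page + 388); [Balaban1985Averaging] (124)–(127) pp. 36–37, Prop. 2 (52)–(54)
p. 26, Proposition 7 p. 43 — through the one-step files named below.

THE PRINT (verbatim).  (3.15) p. 393: *«Q_j(U) = Q(Ū^{j−1})…Q(Ū)Q(U)»*; p. 403: the averaging and projection operators at `U` *«satisfy the same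
bounds»* as at `U = 1`; (3.78)–(3.79) p. 406: *«Q(exp(iB)V) = Q(V) + F₂(B)»*, *«|F₂(B)B′| ≤ O(1) sup|B| sup|B′| … The constant O(1) above depends
only on d and L»* — print's `V` is a GENERAL background, so (3.79) compares `Q` at two nearby backgrounds; iterating it along (3.15) compares the
composites.  Print states no tower version; this file is the [folklore] telescoping.

WHY THIS FILE (cell context).  The NE9 owner's `TOWER-SPECIES-PLAN.md` §2 (e): the two-background ∕ Lipschitz-in-`U` chain of this lineage
((G)=(δ_Q)₂ … (B″)₂, gen 73) one storey up, at print's `k`-level operator `Δ_a(U) = Δ(U) + DR(U)D* + Q_k(U)*aQ_k(U)` ([B9] (3.26)).  Its averaging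
letters are the `k`-level `ρ′_k(U,U′)` (`‖Q′_k(U)λ − Q′_k(U′)λ‖`) and `δ_{Q,k}(U,U′)` (`‖Q_k(U)f − Q_k(U′)f‖`); the owner's `B9Eq315QTowerLipschitz`
(gen 83) is the case `U′ = 1`.  This is the LETTER level only: the junction ∕ chart storey waits for the `k`-level uniform ball (plan §2 (b)).

WHAT IS PROVED (sorry-free; proof lane — no `def`, no `Prop` placeholder, no inequality of the papers asserted hypothesis-free).
* §1 `norm_QprimeTower_le` (`‖Q′_n(R)λ‖_∞ ≤ K^n‖λ‖_∞`, `K = (1+ε)^{d(L−1)}`, transporters `ε`-close to the identity);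
  **`norm_QprimeTower_sub_QprimeTower_le`** — TWO level families of transporters, each `ε`-close to the identity and `δ`-close to each other:
  `‖Q′_n(R)λ − Q′_n(R′)λ‖_∞ ≤ n·K^n·ρ′₂(ε,δ)·‖λ‖_∞`, `ρ′₂ = d(L−1)·δ·(1+ε)^{d(L−1)}` the one-step modulus of `B9Eq319QprimeLipschitzTwoBackgrounds`
  (telescoping `Q′_{n+1}(R) − Q′_{n+1}(R′) = [Q′_n(R) − Q′_n(R′)]Q′(R_n) + Q′_n(R′)[Q′(R_n) − Q′(R′_n)]`).
* §2 `norm_Qtower_apply_le` (`‖(Q_n(U)A)(c)‖ ≤ 2^n·sup‖A‖` in the regime `50(d+1)α_j ≤ 1`); **`norm_Qtower_sub_Qtower_apply_le`** — TWO level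
  families of backgrounds `U_j`, `U′_j` (the base family `U′_j` unit-bounded with `α′_j`-regular block loops, `α′_j ≤ 1∕128`; `U_j` within
  `‖U_j(b)U′_j(b)⁻¹ − 1‖ ≤ δ ≤ 1∕(12288N)`, `N = (2d+2)L`): `‖(Q_n(U)A)(c) − (Q_n(U′)A)(c)‖ ≤ n·2^n·75497472(d+1)N·δ·sup‖A‖` (telescoping with
  NE9 leaf-04's one-step `B9Eq379QLipschitzGeneral.norm_QtorusLin_sub_QtorusLin_le` — [B7] Prop. 7 by the Cauchy route — and §2's operator bound).
* §3 THE READINGS at the letters of `B9Eq326OperatorTower` for two backgrounds `U`, `U′` of the finest torus, modulo the DISPLAYED smallness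
  `‖Ū^j(b) − 1‖, ‖Ū′^j(b) − 1‖ ≤ ε̄`, unit-boundedness `Ū^j(b), Ū′^j(b) ∈ U1` and ADDITIVE closeness `‖Ū^j(b) − Ū′^j(b)‖ ≤ δ̄` of the level averages:
  **`norm_QprimeTowerW_sub_QprimeTowerW_le`** (the `ρ′_k(U,U′)` letter: `‖Q′_k(U)λ − Q′_k(U′)λ‖_∞ ≤ (n+1)·K^{n+1}·d(L−1)·(2M_φM_φ′δ̄)·K₁·(√c₀)⁻¹‖λ‖_{L²}`,
  `K₁ = (1+2M_φM_φ′ε̄)^{d(L−1)}`, `K = K₁`) and **`norm_QkW_sub_QkW_le`** (the `δ_{Q,k}(U,U′)` letter: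
  `‖Q_k(U)f − Q_k(U′)f‖_{L²} ≤ M_φ′M_φ√(c₁|𝔅(T_m)|∕c₀)·(n+1)·2^{n+1}·75497472(d+1)N·δ̄·‖f‖_{L²}`); `norm_mul_inv_sub_one_le_of_mem_U1` converts the
  additive closeness into print's multiplicative letter on `U1`.
MODEL / DECLARED READINGS.  (M1) as `B9Eq315QTowerLipschitz`: the tower of tori `T_{L^j m}`, the level backgrounds ANY two families (§1–§2) resp.
print's `Ū^j = UlevOf …` of two backgrounds of the finest torus (§3); `𝔸` a complete normed `ℂ`-algebra with `‖1‖ = 1`.  (M2) the per-level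
regularity (`α_j`, `α′_j`), regime (`50(d+1)α_j ≤ 1`, `α′_j ≤ 1∕128`), smallness (`ε̄`), unit-boundedness and closeness (`δ̄ ≤ 1∕(12288N)`) of the
level averages are DISPLAYED hypotheses — [Balaban1985Averaging] Prop. 2 (52)–(54) and the Lipschitz continuity of the averaging map `U ↦ Ū`
itself are NOT proved here (the one-background smallness is `B7Eq43AveragedSmallness`; the two-background closeness of the averages has no
tree letter yet).  (M3) constants crude and exponential in the number of levels (`n·K^n`, `n·2^n`), finite lattice, NOT uniform in the volume on
the `L²` carriers (the sup ↔ `L²` comparison), the closeness window is the analyticity radius of the Cauchy route, not print's.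
HONEST SCOPE.  [folklore] telescoping of landed one-step moduli; two displayed letters of a two-general-backgrounds chart of the NE9 chain at
`k` levels, NOT that chart, NOT [B9] Thm 3.11, NOT NE9; NOT summit progress (cell pub-balaban: NE9 NOT PRINTED ∕ NOT PROVED; «NE9 ⇐ the named
binders»; spine PROVED 0∕9; rung (B)+1 on a finite T⁴ — NOT infinite volume, NOT mass gap, NOT Clay).  NEW file importing
`B9Eq315QTowerLipschitz`, `B9Eq379QLipschitzGeneral`, `B9Eq368RLipschitzTwoBackgrounds`; nothing of the owner ∕ leaf-03 lineages' files is
modified.  Net new unproved facts: 0.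
-/

noncomputable section

open scoped BigOperators

namespace Literature.MathematicalPhysics.QuantumFieldTheory.Balaban1983to89.B9Eq315QTowerLipschitzTwoBackgrounds

open B4Sect5Torus (TSite)
open B9SectCLatticeCarrier (Bond)
open B7Prop1Explicit (U1 Wcx boxVec)
open B9Eq311L2Pairing (WL2)
open B11Eq103H1Complex (SiteL2K BondL2K)
open B9Eq319QprimeTorus (fineP QprimeLin)
open B9Eq319QprimeLipschitz (pi_norm_le_WL2_norm)
open B9Eq319QprimeLipschitzTwoBackgrounds (norm_QprimeLin_sub_QprimeLin_le)
open B9Eq315QTorus (perSite perCfg perCfg_apply cornerSite QtorusLin QtorusLin_apply)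
open B9Eq315QLipschitz (norm_apply_le_of_WL2 norm_WL2_le_of_pointwise)
open B9Eq315QTower (towerP UlevOf Qtower Qtower_succ QkOfU QprimeTower QprimeTower_succ)
open B9Eq326OperatorTower (QprimeTowerW QkW)
open B9Eq310HessianOperator (adTransportW)
open B9Eq384RemainderLetters (norm_adTransportW_sub_le)
open B9Eq368RLipschitzTwoBackgrounds (norm_adTransportW_sub_adTransportW_le)
open B9Eq379QLipschitzGeneral (norm_QtorusLin_sub_QtorusLin_le)
open B9Eq315QTowerLipschitz (norm_QprimeLin_le norm_QprimeTower_id_le norm_QprimeTower_sub_id_le norm_QtorusLin_apply_le)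

variable {d : ℕ} (L : ℕ) [NeZero L]

/-! ## §1 The gauge-parameter tower `Q′_n` at two level families of transporters -/

section TowerPrime

variable (m : Fin d → ℕ) [∀ i, NeZero (m i)] {V : Type*} [NormedAddCommGroup V] [NormedSpace ℂ V]

omit [∀ i, NeZero (m i)] in
/-- **`‖Q′_n(R)λ‖_∞ ≤ K^n·‖λ‖_∞`, `K = (1+ε)^{d(L−1)}`**, for a level family of bond transporters each `ε`-close to the identity (the owner's
`norm_QprimeTower_sub_id_le` plus `norm_QprimeTower_id_le`; p. 403 «satisfy the same bounds»).
[cite: Balaban1985BackgroundPropagators, (3.19) p.393, p.403] -/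
theorem norm_QprimeTower_le (Rlev : (n : ℕ) → Bond d (towerP L m (n + 1)) → V →ₗ[ℂ] V) {ε : ℝ} (hε : 0 ≤ ε)
    (hR : ∀ n b v, ‖Rlev n b v - v‖ ≤ ε * ‖v‖) (n : ℕ) (l : TSite d (towerP L m n) → V) :
    ‖QprimeTower L m Rlev n l‖ ≤ ((1 + ε) ^ (d * (L - 1))) ^ n * ‖l‖ := by
  have h1 := norm_QprimeTower_sub_id_le L m Rlev hε hR n l
  have h2 := norm_QprimeTower_id_le L m n l
  have h3 := norm_add_le (QprimeTower L m Rlev n l - QprimeTower L m (fun _ _ => (LinearMap.id : V →ₗ[ℂ] V)) n l)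
    (QprimeTower L m (fun _ _ => (LinearMap.id : V →ₗ[ℂ] V)) n l)
  rw [sub_add_cancel] at h3
  nlinarith [norm_nonneg l]

omit [∀ i, NeZero (m i)] in
/-- **`Q′_n(R)` AGAINST `Q′_n(R′)` ALONG THE TOWER — TWO LEVEL FAMILIES OF TRANSPORTERS**: if every `R_j(b)`, `R′_j(b)` is `ε`-close to the
identity and `‖R_j(b)v − R′_j(b)v‖ ≤ δ‖v‖`, then `‖Q′_n(R)λ − Q′_n(R′)λ‖_∞ ≤ n·K^n·ρ′₂(ε,δ)·‖λ‖_∞` with `K = (1+ε)^{d(L−1)}` and the one-step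
two-background modulus `ρ′₂(ε,δ) = d(L−1)·δ·(1+ε)^{d(L−1)}` of `B9Eq319QprimeLipschitzTwoBackgrounds` — telescoping
`Q′_{n+1}(R)λ − Q′_{n+1}(R′)λ = [Q′_n(R) − Q′_n(R′)](Q′(R_n)λ) + Q′_n(R′)[Q′(R_n)λ − Q′(R′_n)λ]` (print's `F′₂` of (3.81) at a general
background, iterated along (3.19)∕(3.15)). [cite: Balaban1985BackgroundPropagators, (3.19) p.393, p.403, (3.79)–(3.81) p.406] -/
theorem norm_QprimeTower_sub_QprimeTower_le (Rlev Rlev' : (n : ℕ) → Bond d (towerP L m (n + 1)) → V →ₗ[ℂ] V) {ε δ : ℝ}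
    (hε : 0 ≤ ε) (hδ : 0 ≤ δ) (hR : ∀ n b v, ‖Rlev n b v - v‖ ≤ ε * ‖v‖) (hR' : ∀ n b v, ‖Rlev' n b v - v‖ ≤ ε * ‖v‖)
    (hRR' : ∀ n b v, ‖Rlev n b v - Rlev' n b v‖ ≤ δ * ‖v‖) :
    ∀ (n : ℕ) (l : TSite d (towerP L m n) → V),
      ‖QprimeTower L m Rlev n l - QprimeTower L m Rlev' n l‖ ≤
        (n : ℝ) * ((1 + ε) ^ (d * (L - 1))) ^ n * (((d * (L - 1) : ℕ) : ℝ) * δ * (1 + ε) ^ (d * (L - 1))) * ‖l‖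
  | 0, l => by simp
  | n + 1, l => by
    set K : ℝ := (1 + ε) ^ (d * (L - 1)) with hK
    set ρ : ℝ := ((d * (L - 1) : ℕ) : ℝ) * δ * (1 + ε) ^ (d * (L - 1)) with hρ
    have hK1 : 1 ≤ K := one_le_pow₀ (by linarith)
    have hK0 : 0 ≤ K := by linarith
    have hρ0 : 0 ≤ ρ := by positivity
    show ‖QprimeTower L m Rlev n (QprimeLin L (towerP L m n) (Rlev n) l) -
        QprimeTower L m Rlev' n (QprimeLin L (towerP L m n) (Rlev' n) l)‖ ≤ _
    set x := QprimeLin L (towerP L m n) (Rlev n) l with hx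
    set x' := QprimeLin L (towerP L m n) (Rlev' n) l with hx'
    have hsplit : QprimeTower L m Rlev n x - QprimeTower L m Rlev' n x' =
        (QprimeTower L m Rlev n x - QprimeTower L m Rlev' n x) + QprimeTower L m Rlev' n (x - x') := by
      rw [map_sub]; abel
    have ih := norm_QprimeTower_sub_QprimeTower_le Rlev Rlev' hε hδ hR hR' hRR' n x
    have hxn : ‖x‖ ≤ K * ‖l‖ := norm_QprimeLin_le L (towerP L m n) (Rlev n) hε (hR n) l
    have h2 : ‖QprimeTower L m Rlev' n (x - x')‖ ≤ K ^ n * ‖x - x'‖ := norm_QprimeTower_le L m Rlev' hε hR' n (x - x')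
    have hxx' : ‖x - x'‖ ≤ ρ * ‖l‖ :=
      norm_QprimeLin_sub_QprimeLin_le L (towerP L m n) (Rlev n) (Rlev' n) hε hδ (hR n) (hR' n) (hRR' n) l
    have hn0 : (0 : ℝ) ≤ n := Nat.cast_nonneg n
    have hcoef : 0 ≤ (n : ℝ) * K ^ n * ρ := by positivity
    have key : 0 ≤ K ^ n * ρ * ‖l‖ * (K - 1) := mul_nonneg (by positivity) (by linarith)
    calc ‖QprimeTower L m Rlev n x - QprimeTower L m Rlev' n x'‖
        ≤ ‖QprimeTower L m Rlev n x - QprimeTower L m Rlev' n x‖ + ‖QprimeTower L m Rlev' n (x - x')‖ := by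
          rw [hsplit]; exact norm_add_le _ _
      _ ≤ (n : ℝ) * K ^ n * ρ * ‖x‖ + K ^ n * ‖x - x'‖ := add_le_add ih h2
      _ ≤ (n : ℝ) * K ^ n * ρ * (K * ‖l‖) + K ^ n * (ρ * ‖l‖) :=
          add_le_add (mul_le_mul_of_nonneg_left hxn hcoef) (mul_le_mul_of_nonneg_left hxx' (by positivity))
      _ ≤ ((n + 1 : ℕ) : ℝ) * K ^ (n + 1) * ρ * ‖l‖ := by
          push_cast
          rw [pow_succ]
          nlinarith [key]

end TowerPrime

/-! ## §2 The vector-field tower `Q_n` at two level families of backgrounds -/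

section TowerQ

variable {𝔸 : Type*} [NormedRing 𝔸] [NormedAlgebra ℂ 𝔸] [CompleteSpace 𝔸] [NormOneClass 𝔸]
  (m : Fin d → ℕ) [∀ i, NeZero (m i)] (hL : 1 ≤ L)
  (Ulev : (n : ℕ) → Bond d (towerP L m (n + 1)) → 𝔸ˣ) (α : ℕ → ℝ) (hα1 : ∀ j, α j ≤ 1 / 64)
  (hU1 : ∀ (j : ℕ) (x : B7Prop1Explicit.Site d) (κ : Fin d), perCfg (towerP L m (j + 1)) (Ulev j) x κ ∈ U1 𝔸)
  (hreg : ∀ (j : ℕ) (y : TSite d (towerP L m j)) (κ : Fin d) (r : Fin d → Fin L),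
    ‖((Wcx L (perCfg (towerP L m (j + 1)) (Ulev j)) (cornerSite L y) κ (boxVec L r) : 𝔸ˣ) : 𝔸) - 1‖ ≤ α j)
  (hα2 : ∀ j, 50 * (d + 1) * α j ≤ 1)
  (Ulev' : (n : ℕ) → Bond d (towerP L m (n + 1)) → 𝔸ˣ) (α' : ℕ → ℝ) (hα1' : ∀ j, α' j ≤ 1 / 64)
  (hU1' : ∀ (j : ℕ) (x : B7Prop1Explicit.Site d) (κ : Fin d), perCfg (towerP L m (j + 1)) (Ulev' j) x κ ∈ U1 𝔸)
  (hreg' : ∀ (j : ℕ) (y : TSite d (towerP L m j)) (κ : Fin d) (r : Fin d → Fin L),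
    ‖((Wcx L (perCfg (towerP L m (j + 1)) (Ulev' j)) (cornerSite L y) κ (boxVec L r) : 𝔸ˣ) : 𝔸) - 1‖ ≤ α' j)
  (hα2' : ∀ j, 50 * (d + 1) * α' j ≤ 1) (hα128' : ∀ j, α' j ≤ 1 / 128)
  {δ : ℝ} (hδ : 0 ≤ δ) (hδmax : δ ≤ 1 / (12288 * ((2 * (d * L) + L + L : ℕ) : ℝ)))
  (hUδ : ∀ (j : ℕ) (b : Bond d (towerP L m (j + 1))), ‖((Ulev j b : 𝔸ˣ) : 𝔸) * (((Ulev' j b)⁻¹ : 𝔸ˣ) : 𝔸) - 1‖ ≤ δ)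

include hα2 in
/-- **`‖(Q_n(U)A)(c)‖ ≤ 2^n·sup‖A‖` along the tower** in the regime `50(d+1)α_j ≤ 1` (each factor is bounded by `1 + 50(d+1)α_j ≤ 2`,
[Balaban1985Averaging] (126) = the owner's `norm_QtorusLin_apply_le`). [cite: Balaban1985Averaging, (126) p.36; Balaban1985BackgroundPropagators, (3.15) p.393, p.403] -/
theorem norm_Qtower_apply_le : ∀ (n : ℕ) (A : Bond d (towerP L m n) → 𝔸) {a : ℝ}, 0 ≤ a → (∀ b, ‖A b‖ ≤ a) → ∀ c : Bond d m,
    ‖Qtower L m hL Ulev α hα1 hU1 hreg n A c‖ ≤ 2 ^ n * a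
  | 0, A, a, _, hA, c => by
    rw [pow_zero, one_mul]
    exact hA c
  | n + 1, A, a, ha, hA, c => by
    show ‖Qtower L m hL Ulev α hα1 hU1 hreg n (QtorusLin L (towerP L m n) hL (Ulev n) (hα1 n) (hU1 n) (hreg n) A) c‖ ≤ _
    have hx : ∀ b, ‖QtorusLin L (towerP L m n) hL (Ulev n) (hα1 n) (hU1 n) (hreg n) A b‖ ≤ 2 * a := fun b => by
      have h := norm_QtorusLin_apply_le L (towerP L m n) hL (Ulev n) (hα1 n) (hU1 n) (hreg n) A ha hA b
      have hα0 : 0 ≤ α n := (norm_nonneg _).trans (hreg n b.1 b.2 fun _ => 0)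
      exact h.trans (mul_le_mul_of_nonneg_right (by linarith [hα2 n]) ha)
    refine (norm_Qtower_apply_le n _ (by positivity) hx c).trans (le_of_eq ?_)
    rw [pow_succ]; ring

include hα2 hα2' hα128' hδ hδmax hUδ in
/-- **`Q_n(U)` AGAINST `Q_n(U′)` ALONG THE TOWER — TWO LEVEL FAMILIES OF BACKGROUNDS**, per coarse bond: for a base family `U′_j`
(unit-bounded, `α′_j`-regular extended block loops with `α′_j ≤ 1∕128`, regime `50(d+1)α′_j ≤ 1`) and a family `U_j` (regime `50(d+1)α_j ≤ 1`)
with `‖U_j(b)U′_j(b)⁻¹ − 1‖ ≤ δ ≤ 1∕(12288N)` (`N = (2d+2)L`): `‖(Q_n(U)A)(c) − (Q_n(U′)A)(c)‖ ≤ n·2^n·75497472(d+1)N·δ·sup‖A‖` — telescoping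
`Q_{n+1}(U) − Q_{n+1}(U′) = [Q_n(U) − Q_n(U′)]Q(U_n) + Q_n(U′)[Q(U_n) − Q(U′_n)]` with NE9 leaf-04's one-step two-background modulus
`norm_QtorusLin_sub_QtorusLin_le` ([B9] (3.79) at a general `V`, [B7] Prop. 7 by the Cauchy route) and §2's operator bound (print's `F₂` of
(3.79) iterated along (3.15)). [cite: Balaban1985BackgroundPropagators, (3.15) p.393, (3.78)–(3.79) p.406; Balaban1985Averaging, Proposition 7 p.43, (126) p.36] -/
theorem norm_Qtower_sub_Qtower_apply_le : ∀ (n : ℕ) (A : Bond d (towerP L m n) → 𝔸) {a : ℝ}, 0 ≤ a → (∀ b, ‖A b‖ ≤ a) →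
    ∀ c : Bond d m,
      ‖Qtower L m hL Ulev α hα1 hU1 hreg n A c - Qtower L m hL Ulev' α' hα1' hU1' hreg' n A c‖ ≤
        (n : ℝ) * 2 ^ n * (75497472 * ((d : ℝ) + 1) * ((2 * (d * L) + L + L : ℕ) : ℝ) * δ) * a
  | 0, A, a, _, _, c => by simp
  | n + 1, A, a, ha, hA, c => by
    set G : ℝ := 75497472 * ((d : ℝ) + 1) * ((2 * (d * L) + L + L : ℕ) : ℝ) * δ with hG
    have hG0 : 0 ≤ G := by positivity
    show ‖Qtower L m hL Ulev α hα1 hU1 hreg n (QtorusLin L (towerP L m n) hL (Ulev n) (hα1 n) (hU1 n) (hreg n) A) c -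
        Qtower L m hL Ulev' α' hα1' hU1' hreg' n (QtorusLin L (towerP L m n) hL (Ulev' n) (hα1' n) (hU1' n) (hreg' n) A) c‖ ≤ _
    set x := QtorusLin L (towerP L m n) hL (Ulev n) (hα1 n) (hU1 n) (hreg n) A with hx
    set x' := QtorusLin L (towerP L m n) hL (Ulev' n) (hα1' n) (hU1' n) (hreg' n) A with hx'
    have hsplit : Qtower L m hL Ulev α hα1 hU1 hreg n x c - Qtower L m hL Ulev' α' hα1' hU1' hreg' n x' c =
        (Qtower L m hL Ulev α hα1 hU1 hreg n x c - Qtower L m hL Ulev' α' hα1' hU1' hreg' n x c) +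
          Qtower L m hL Ulev' α' hα1' hU1' hreg' n (x - x') c := by
      rw [map_sub, Pi.sub_apply]; abel
    have hxb : ∀ b, ‖x b‖ ≤ 2 * a := fun b => by
      have h := norm_QtorusLin_apply_le L (towerP L m n) hL (Ulev n) (hα1 n) (hU1 n) (hreg n) A ha hA b
      have hα0 : 0 ≤ α n := (norm_nonneg _).trans (hreg n b.1 b.2 fun _ => 0)
      exact h.trans (mul_le_mul_of_nonneg_right (by linarith [hα2 n]) ha)
    have hxx' : ∀ b, ‖x b - x' b‖ ≤ G * a := fun b =>
      norm_QtorusLin_sub_QtorusLin_le L (towerP L m n) hL (Ulev n) (hα1 n) (hU1 n) (hreg n) (Ulev' n) (hα1' n) (hU1' n) (hreg' n)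
        (hα128' n) hδ hδmax (hUδ n) A hA b
    have ih := norm_Qtower_sub_Qtower_apply_le n x (by positivity : (0 : ℝ) ≤ 2 * a) hxb c
    have h2 := norm_Qtower_apply_le L m hL Ulev' α' hα1' hU1' hreg' hα2' n (x - x') (by positivity : (0 : ℝ) ≤ G * a)
      (fun b => by rw [Pi.sub_apply]; exact hxx' b) c
    have key : 0 ≤ 2 ^ n * G * a := by positivity
    calc ‖Qtower L m hL Ulev α hα1 hU1 hreg n x c - Qtower L m hL Ulev' α' hα1' hU1' hreg' n x' c‖
        ≤ ‖Qtower L m hL Ulev α hα1 hU1 hreg n x c - Qtower L m hL Ulev' α' hα1' hU1' hreg' n x c‖ +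
            ‖Qtower L m hL Ulev' α' hα1' hU1' hreg' n (x - x') c‖ := by rw [hsplit]; exact norm_add_le _ _
      _ ≤ (n : ℝ) * 2 ^ n * G * (2 * a) + 2 ^ n * (G * a) := add_le_add ih h2
      _ ≤ ((n + 1 : ℕ) : ℝ) * 2 ^ (n + 1) * G * a := by
          push_cast
          rw [pow_succ]
          nlinarith [key]

end TowerQ

/-! ## §3 The readings at the tower letters of `B9Eq326OperatorTower`, for two backgrounds of the finest torus -/

section Readings

variable {𝔸 : Type*} [NormedRing 𝔸] [NormedAlgebra ℂ 𝔸] [CompleteSpace 𝔸] [NormOneClass 𝔸]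

omit [NormedAlgebra ℂ 𝔸] [CompleteSpace 𝔸] in
/-- `‖uu′⁻¹ − 1‖ ≤ ‖u − u′‖` for `u′ ∈ U1` (`uu′⁻¹ − 1 = (u − u′)u′⁻¹`, `‖u′⁻¹‖ ≤ 1`): the chain's ADDITIVE closeness letter of two level
backgrounds gives print's MULTIPLICATIVE letter `exp(iB)V` vs `V` of (3.79). [cite: Balaban1985BackgroundPropagators, (3.78)–(3.79) p.406] -/
theorem norm_mul_inv_sub_one_le_of_mem_U1 {u u' : 𝔸ˣ} (hu' : u' ∈ U1 𝔸) {δ : ℝ} (h : ‖(u : 𝔸) - (u' : 𝔸)‖ ≤ δ) :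
    ‖(u : 𝔸) * ((u'⁻¹ : 𝔸ˣ) : 𝔸) - 1‖ ≤ δ := by
  have e : (u : 𝔸) * ((u'⁻¹ : 𝔸ˣ) : 𝔸) - 1 = ((u : 𝔸) - (u' : 𝔸)) * ((u'⁻¹ : 𝔸ˣ) : 𝔸) := by
    rw [sub_mul, Units.mul_inv]
  rw [e]
  exact (norm_mul_le _ _).trans ((mul_le_of_le_one_right (norm_nonneg _) (B7Prop1Explicit.mem_U1.1 hu').2).trans h)

variable (m : Fin d → ℕ) [∀ i, NeZero (m i)] (n : ℕ) (hL : 1 ≤ L)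
  {W : Type*} [NormedAddCommGroup W] [InnerProductSpace ℂ W] (φ : W ≃ₗ[ℂ] 𝔸) {Mφ Mφ' : ℝ} (hMφ : 0 ≤ Mφ) (hMφ' : 0 ≤ Mφ')
  (hφ : ∀ w, ‖φ w‖ ≤ Mφ * ‖w‖) (hφ' : ∀ X, ‖φ.symm X‖ ≤ Mφ' * ‖X‖) {c₀ c₁ : ℝ} [Fact (0 < c₀)] [Fact (0 < c₁)]
  (U U' : Bond d (towerP L m (n + 1)) → 𝔸ˣ)
  (α : ℕ → ℝ) (hα1 : ∀ j, α j ≤ 1 / 64)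
  (hU1 : ∀ (j : ℕ) (x : B7Prop1Explicit.Site d) (κ : Fin d), perCfg (towerP L m (j + 1)) (UlevOf L m (n + 1) U j) x κ ∈ U1 𝔸)
  (hreg : ∀ (j : ℕ) (y : TSite d (towerP L m j)) (κ : Fin d) (r : Fin d → Fin L),
    ‖((Wcx L (perCfg (towerP L m (j + 1)) (UlevOf L m (n + 1) U j)) (cornerSite L y) κ (boxVec L r) : 𝔸ˣ) : 𝔸) - 1‖ ≤ α j)
  (hα2 : ∀ j, 50 * (d + 1) * α j ≤ 1)
  (α' : ℕ → ℝ) (hα1' : ∀ j, α' j ≤ 1 / 64)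
  (hU1' : ∀ (j : ℕ) (x : B7Prop1Explicit.Site d) (κ : Fin d), perCfg (towerP L m (j + 1)) (UlevOf L m (n + 1) U' j) x κ ∈ U1 𝔸)
  (hreg' : ∀ (j : ℕ) (y : TSite d (towerP L m j)) (κ : Fin d) (r : Fin d → Fin L),
    ‖((Wcx L (perCfg (towerP L m (j + 1)) (UlevOf L m (n + 1) U' j)) (cornerSite L y) κ (boxVec L r) : 𝔸ˣ) : 𝔸) - 1‖ ≤ α' j)
  (hα2' : ∀ j, 50 * (d + 1) * α' j ≤ 1) (hα128' : ∀ j, α' j ≤ 1 / 128)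
  {εU : ℝ} (hεU : 0 ≤ εU)
  (hUε : ∀ (j : ℕ) (b : Bond d (towerP L m (j + 1))), ‖((UlevOf L m (n + 1) U j b : 𝔸ˣ) : 𝔸) - 1‖ ≤ εU)
  (hUε' : ∀ (j : ℕ) (b : Bond d (towerP L m (j + 1))), ‖((UlevOf L m (n + 1) U' j b : 𝔸ˣ) : 𝔸) - 1‖ ≤ εU)
  (hUb : ∀ (j : ℕ) (b : Bond d (towerP L m (j + 1))), UlevOf L m (n + 1) U j b ∈ U1 𝔸)
  (hUb' : ∀ (j : ℕ) (b : Bond d (towerP L m (j + 1))), UlevOf L m (n + 1) U' j b ∈ U1 𝔸)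
  {δU : ℝ} (hδU : 0 ≤ δU) (hδUmax : δU ≤ 1 / (12288 * ((2 * (d * L) + L + L : ℕ) : ℝ)))
  (hUU' : ∀ (j : ℕ) (b : Bond d (towerP L m (j + 1))),
    ‖((UlevOf L m (n + 1) U j b : 𝔸ˣ) : 𝔸) - ((UlevOf L m (n + 1) U' j b : 𝔸ˣ) : 𝔸)‖ ≤ δU)

include hφ hφ' hMφ hMφ' hεU hUε hUε' hUb hUb' hδU hUU' in
/-- **THE TOWER LETTER `ρ′_k(U,U′)`**: `‖Q′_k(U)λ − Q′_k(U′)λ‖_∞ ≤ (n+1)·K^{n+1}·d(L−1)·(2M_φM_φ′δ̄)·K₁·(√c₀)⁻¹·‖λ‖_{L²}` with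
`K = K₁ = (1 + 2M_φM_φ′ε̄)^{d(L−1)}`, for two backgrounds of the finest torus whose level averages `Ū^j`, `Ū′^j` are `ε̄`-small, `U1`-valued and
`δ̄`-close bondwise (DISPLAYED — [Balaban1985Averaging] Prop. 2 and the continuity of `U ↦ Ū`, not proved here): the fibre transporters
`R(Ū^j(b))`, `R(Ū′^j(b))` are `2M_φM_φ′ε̄`-close to the identity (`norm_adTransportW_sub_le`) and `2M_φM_φ′δ̄`-close to each other
(`norm_adTransportW_sub_adTransportW_le`), §1, and `‖λ‖_∞ ≤ (√c₀)⁻¹‖λ‖_{L²}`. [cite: Balaban1985BackgroundPropagators, (3.19) p.393, (3.79)–(3.81) p.406; Balaban1985Averaging, Prop. 2 (52)–(54) p.26] -/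
theorem norm_QprimeTowerW_sub_QprimeTowerW_le (l : SiteL2K ℂ d (towerP L m (n + 1)) c₀ W) :
    ‖QprimeTowerW L m n φ U (c₀ := c₀) l - QprimeTowerW L m n φ U' (c₀ := c₀) l‖ ≤
      ((n : ℝ) + 1) * ((1 + 2 * Mφ * Mφ' * εU) ^ (d * (L - 1))) ^ (n + 1) *
        (((d * (L - 1) : ℕ) : ℝ) * (2 * Mφ * Mφ' * δU) * (1 + 2 * Mφ * Mφ' * εU) ^ (d * (L - 1))) * ((Real.sqrt c₀)⁻¹ * ‖l‖) := by
  have hε : 0 ≤ 2 * Mφ * Mφ' * εU := by positivity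
  have hδ : 0 ≤ 2 * Mφ * Mφ' * δU := by positivity
  have hR : ∀ (j : ℕ) (b : Bond d (towerP L m (j + 1))) (v : W),
      ‖adTransportW φ (UlevOf L m (n + 1) U j) b v - v‖ ≤ 2 * Mφ * Mφ' * εU * ‖v‖ :=
    fun j b v => norm_adTransportW_sub_le φ hφ hφ' hMφ' _ b (hUb j b) (hUε j b) v
  have hR' : ∀ (j : ℕ) (b : Bond d (towerP L m (j + 1))) (v : W),
      ‖adTransportW φ (UlevOf L m (n + 1) U' j) b v - v‖ ≤ 2 * Mφ * Mφ' * εU * ‖v‖ :=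
    fun j b v => norm_adTransportW_sub_le φ hφ hφ' hMφ' _ b (hUb' j b) (hUε' j b) v
  have hRR' : ∀ (j : ℕ) (b : Bond d (towerP L m (j + 1))) (v : W),
      ‖adTransportW φ (UlevOf L m (n + 1) U j) b v - adTransportW φ (UlevOf L m (n + 1) U' j) b v‖ ≤ 2 * Mφ * Mφ' * δU * ‖v‖ :=
    fun j b v => norm_adTransportW_sub_adTransportW_le L (towerP L m j) φ hφ hφ' hMφ' _ _ b (hUb j b) (hUb' j b) (hUU' j b) v
  have h := norm_QprimeTower_sub_QprimeTower_le L m (fun j => adTransportW φ (UlevOf L m (n + 1) U j))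
    (fun j => adTransportW φ (UlevOf L m (n + 1) U' j)) hε hδ hR hR' hRR' (n + 1)
    (WL2.linearEquiv ℂ ℂ (fun _ : TSite d (towerP L m (n + 1)) => c₀) l)
  have hcoef : 0 ≤ ((n : ℝ) + 1) * ((1 + 2 * Mφ * Mφ' * εU) ^ (d * (L - 1))) ^ (n + 1) *
      (((d * (L - 1) : ℕ) : ℝ) * (2 * Mφ * Mφ' * δU) * (1 + 2 * Mφ * Mφ' * εU) ^ (d * (L - 1))) := by positivity
  rw [QprimeTowerW, QprimeTowerW, LinearMap.comp_apply, LinearMap.comp_apply, LinearEquiv.coe_toLinearMap]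
  rw [Nat.cast_succ] at h
  exact h.trans (mul_le_mul_of_nonneg_left (pi_norm_le_WL2_norm L (towerP L m n) l) hcoef)

include hφ hφ' hMφ hMφ' hα2 hα2' hα128' hUb' hδU hδUmax hUU' in
/-- **THE TOWER LETTER `δ_{Q,k}(U,U′)`**: `‖Q_k(U)f − Q_k(U′)f‖_{L²} ≤ M_φ′·M_φ·√(c₁|𝔅(T_m)|∕c₀)·(n+1)·2^{n+1}·75497472(d+1)N·δ̄·‖f‖_{L²}` for two
backgrounds of the finest torus in the per-level regimes (`50(d+1)α_j ≤ 1` for both, `α′_j ≤ 1∕128` for the base `U′`) whose level averages are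
`δ̄`-close bondwise, `Ū′^j(b) ∈ U1`, `δ̄ ≤ 1∕(12288N)` (DISPLAYED): §2 at the `𝔸`-valued function `b ↦ φ(f(b))` (sup `≤ M_φ‖f‖∕√c₀`), read back
along `φ⁻¹` and summed with the coarse weight (the owner's one-background road `norm_QkW_sub_flat_le` between two backgrounds).
[cite: Balaban1985BackgroundPropagators, (3.15)–(3.16) p.393, (3.78)–(3.79) p.406; Balaban1985Averaging, Proposition 7 p.43, (126) p.36] -/
theorem norm_QkW_sub_QkW_le (f : BondL2K ℂ d (towerP L m (n + 1)) c₀ W) :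
    ‖QkW L m n φ U hL α hα1 hU1 hreg (c₀ := c₀) (c₁ := c₁) f - QkW L m n φ U' hL α' hα1' hU1' hreg' (c₀ := c₀) (c₁ := c₁) f‖ ≤
      Mφ' * Mφ * Real.sqrt (c₁ * Fintype.card (Bond d m) / c₀) *
        (((n : ℝ) + 1) * 2 ^ (n + 1) * (75497472 * ((d : ℝ) + 1) * ((2 * (d * L) + L + L : ℕ) : ℝ) * δU)) * ‖f‖ := by
  have hc₀ : 0 < c₀ := Fact.out
  -- print's multiplicative closeness letter from the chain's additive one
  have hUδ : ∀ (j : ℕ) (b : Bond d (towerP L m (j + 1))),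
      ‖((UlevOf L m (n + 1) U j b : 𝔸ˣ) : 𝔸) * (((UlevOf L m (n + 1) U' j b)⁻¹ : 𝔸ˣ) : 𝔸) - 1‖ ≤ δU :=
    fun j b => norm_mul_inv_sub_one_le_of_mem_U1 (hUb' j b) (hUU' j b)
  set g : Bond d (towerP L m (n + 1)) → 𝔸 := fun b => φ (WL2.equiv ℂ _ W f b) with hg
  set a : ℝ := Mφ * (‖f‖ / Real.sqrt c₀) with ha_def
  have ha0 : 0 ≤ a := mul_nonneg hMφ (div_nonneg (norm_nonneg f) (Real.sqrt_nonneg _))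
  have ha : ∀ b, ‖g b‖ ≤ a := fun b => (hφ _).trans (mul_le_mul_of_nonneg_left (norm_apply_le_of_WL2 f b) hMφ)
  set G : ℝ := 75497472 * ((d : ℝ) + 1) * ((2 * (d * L) + L + L : ℕ) : ℝ) * δU with hG
  have hG0 : 0 ≤ G := by positivity
  have hpt : ∀ c : Bond d m,
      ‖WL2.equiv ℂ _ W (QkW L m n φ U hL α hα1 hU1 hreg (c₀ := c₀) (c₁ := c₁) f -
          QkW L m n φ U' hL α' hα1' hU1' hreg' (c₀ := c₀) (c₁ := c₁) f) c‖ ≤ Mφ' * (((n : ℝ) + 1) * 2 ^ (n + 1) * G * a) := by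
    intro c
    rw [WL2.equiv_sub, Pi.sub_apply]
    show ‖φ.symm (QkOfU L m hL (n + 1) U α hα1 hU1 hreg g c) - φ.symm (QkOfU L m hL (n + 1) U' α' hα1' hU1' hreg' g c)‖ ≤ _
    rw [← map_sub]
    have h := norm_Qtower_sub_Qtower_apply_le L m hL (UlevOf L m (n + 1) U) α hα1 hU1 hreg hα2 (UlevOf L m (n + 1) U') α' hα1' hU1'
      hreg' hα2' hα128' hδU hδUmax hUδ (n + 1) g ha0 ha c
    rw [Nat.cast_succ] at h
    exact (hφ' _).trans (mul_le_mul_of_nonneg_left h hMφ')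
  have hB0 : 0 ≤ Mφ' * (((n : ℝ) + 1) * 2 ^ (n + 1) * G * a) := by positivity
  refine (norm_WL2_le_of_pointwise _ hB0 hpt).trans (le_of_eq ?_)
  rw [ha_def, Real.sqrt_div' _ hc₀.le]
  ring

end Readings

end Literature.MathematicalPhysics.QuantumFieldTheory.Balaban1983to89.B9Eq315QTowerLipschitzTwoBackgrounds

end
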